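import Summits.QuantumFields.BalabanUV.Beta.EriceRemainderEnclosureHistoryRenewalWitnessRate

/-!
# EriceRemainderEnclosureHistoryRenewalWitnessEnvelope — (E35d) THE β-LEVEL ENVELOPE OF THE RATE ROW: admissible families with
# `ln(1∕disc_j) ≍ √(j·log j)` — no `C·exp(−A·j^p)` two-run matching rate with `p > ½` without `FadingMemory`; (E33g)'s exponent `½`
# is optimal up to the logarithm AT THE β LEVEL (the β-level companion of (E34b) `rowSystem_not_stretched_pow`)

Cell `pub-balaban`, β-function sub-cell, BINDER row D4 «RemainderConst leaves for Bałaban's split» (`HOME/BINDER-OWNERS.md`; owner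
lineage `b2b-balaban-beta-an4`; this file by co-owner #2 lineage `b2b-balaban-beta-d4-p2`, generation 37), β-FLOW TEAM duty (1),
FREEZE (0) honoured (def-free; no new leaf, no new hypothesis shape).  Part 4 of station (E35) over part 2 `…WitnessRuns`
(`witness_core`, any firing pattern) and part 3 `…WitnessRate` (`tendsto_succ_pow_mul_pow`).

HONEST FRAMING (page 1, verbatim and binding).  *"Discharging BetaPertH makes Bałaban's UV stability UNCONDITIONAL — a real
constructive-QFT result; it is NOT the continuum limit and NOT the Clay problem."*  THIS FILE DISCHARGES NOTHING OF THE KIND.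
[folklore] real analysis: a WITNESS about the cell's own NOT-IN-PRINT binders (GAPS G-t4-U2-1∕-2), never an assertion about Bałaban's
(1.22).  Row D4 class UNCHANGED (critical-path width 0; instance 0∕1; D4 DISCHARGE NO DATE); NOT B12 Thm 2, NOT BetaPertH, NOT continuum,
NOT Clay.  HONEST DEPENDENCY: continuum YM on T⁴ ⇐ BetaPertH ∧ nine spine estimates (0/9 proved); BetaPertH ⇐ (D1) ∧ (D4) ∧ CAP+tail;
G-an2-4 gates asym, D1 and NE2/3/4.

THE POINT (census sense (α)).  Part 3's staged pattern beats every geometric `Cκ^j` but decays like `exp(−Θ(j^{2∕3}))`; (E34a)'s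
extremal solutions of the ROW SYSTEM sit at `exp(−Θ(√j·log j))` and (E33g) bounds everything by `exp(−Θ(√j))` from above.  THIS FILE
realizes the row system's envelope with ADMISSIBLE FAMILIES: the two-parameter pattern (§1: depth `E`, `s + 1` stages, ages
`a_t = 2E(t+1) + 1`, rows `k_t = 2E + t(2E+1) + E·t(t+1)`, amplitude ratio `θ^{2E}`, row cost
`≤ (1 + 1∕γ² + 5(b+c))³(c∕b+1)(E+1)³(s+1)⁷θ^{2E}`, discrepancy `≥ cθ^{2E(s+1)}∕(s+1)` at `j = k_s`) at the DYADIC size (§2: `s = 2^m`,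
`E = N·m`, `θ^{2N} ≤ 1∕256`, so the cost is `≤ 128(N+1)³(m+1)³(1∕2)^m` times the constant and `j ≥ 4^m`): `ln(1∕disc_j) =
2N|log θ|·m·(2^m+1) + log(2^m+1) − log c ≍ √j·log j`.  §3 `not_stretched_pow`: for ALL `c θ γ b M` and EVERY `p > ½`, `A > 0`, `C`
some member of (E33g)'s binder class (rows `≤ M`) and some `j ≤ K` have `disc gA gB j > C·exp(−A·j^p)` (`log x = o(x^{2p−1})`, the
analytic step of (E34b) verbatim).  With (E33g) from above: AT THE β LEVEL the two-run matching rate of the class is stretched-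
exponential with exponent EXACTLY `½` up to logarithms — (E34)'s method-level verdict is the truth of the binder class.

WHAT IS PROVED (0 `def`, 0 sorry; [folklore]).  §1 `twoParam_first_factor_le`, `twoParam_second_factor_le`, `twoParam_cost_le`,
`witness_twoParam`; §2 `exists_depth_unit`, `dyadic_cost_le`, `dyadic_log_le`, `exists_dyadic`; §3 `not_stretched_pow`.
-/

noncomputable section
open Finset Filter Topology Asymptotics

namespace Summit.QuantumFields.BalabanUV.Beta.EriceRemainderEnclosureHistoryRenewalWitnessEnvelope

open Literature.MathematicalPhysics.QuantumFieldTheory.Balaban1983to89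
open Literature.MathematicalPhysics.QuantumFieldTheory.Balaban1983to89.FlowStep
open Literature.MathematicalPhysics.QuantumFieldTheory.Balaban1983to89.T4CouplingMatching
open Summit.QuantumFields.BalabanUV.Beta.EriceRemainderEnclosureHistoryRenewalWitnessRuns (witness_core)
open Summit.QuantumFields.BalabanUV.Beta.EriceRemainderEnclosureHistoryRenewalWitnessRate (tendsto_succ_pow_mul_pow)

/-! ## §1 The two-parameter pattern: depth `E`, `s + 1` stages, ages `a_t = 2E(t+1) + 1`, rows `k_t = 2E + t(2E+1) + E·t(t+1)` -/

/-- First factor of the two-parameter cost: `k_s + 2 ≤ 5(E+1)(s+1)²`, so the cube is `≤ (1 + 1∕γ² + 5(b+c))³·(E+1)³·(s+1)⁶`. [folklore] -/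
theorem twoParam_first_factor_le {c γ b : ℝ} (hc : 0 < c) (hγ : 0 < γ) (hb : 0 < b) (E s : ℕ)
    {k : ℕ → ℕ} (hk : ∀ t, k t = 2 * E + t * (2 * E + 1) + E * t * (t + 1)) :
    (1 + (1 / γ ^ 2 + (b + c) * (k s + 2))) ^ 3
      ≤ (1 + 1 / γ ^ 2 + 5 * (b + c)) ^ 3 * ((E : ℝ) + 1) ^ 3 * ((s : ℝ) + 1) ^ 6 := by
  have hx : (0 : ℝ) ≤ (s : ℝ) := Nat.cast_nonneg s
  have hE : (0 : ℝ) ≤ (E : ℝ) := Nat.cast_nonneg E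
  set P : ℝ := ((E : ℝ) + 1) * ((s : ℝ) + 1) ^ 2 with hP
  have hP1 : (1 : ℝ) ≤ P := by
    have h1 : (1 : ℝ) ≤ (E : ℝ) + 1 := by linarith
    have h2 : (1 : ℝ) ≤ ((s : ℝ) + 1) ^ 2 := one_le_pow₀ (by linarith)
    nlinarith
  have hk2 : ((k s : ℕ) : ℝ) + 2 ≤ 5 * P := by
    rw [hk, hP]; push_cast
    nlinarith [mul_nonneg hE hx, mul_nonneg (mul_nonneg hE hx) hx, mul_nonneg hx hx]
  have hG0 : (0 : ℝ) ≤ 1 / γ ^ 2 := by positivity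
  have hF : 1 + (1 / γ ^ 2 + (b + c) * (k s + 2)) ≤ (1 + 1 / γ ^ 2 + 5 * (b + c)) * P := by
    have h3 : (b + c) * ((k s : ℝ) + 2) ≤ (b + c) * (5 * P) := mul_le_mul_of_nonneg_left hk2 (by positivity)
    have h4 : (1 + 1 / γ ^ 2) ≤ (1 + 1 / γ ^ 2) * P := le_mul_of_one_le_right (by positivity) hP1
    have e : (1 + 1 / γ ^ 2 + 5 * (b + c)) * P = (1 + 1 / γ ^ 2) * P + (b + c) * (5 * P) := by ring
    linarith
  have hF0 : 0 ≤ 1 + (1 / γ ^ 2 + (b + c) * (k s + 2)) := by positivity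
  calc (1 + (1 / γ ^ 2 + (b + c) * (k s + 2))) ^ 3 ≤ ((1 + 1 / γ ^ 2 + 5 * (b + c)) * P) ^ 3 :=
        pow_le_pow_left₀ hF0 hF 3
    _ = (1 + 1 / γ ^ 2 + 5 * (b + c)) ^ 3 * ((E : ℝ) + 1) ^ 3 * ((s : ℝ) + 1) ^ 6 := by
        rw [hP, mul_pow, mul_pow, ← pow_mul]; ring

/-- Second factor of the two-parameter cost: all amplitude ratios are `θ^{2E}`, so
`cθ^{a_0−1}∕((s+1)b) + Σ_{t<s} θ^{a_{t+1}−1}∕θ^{a_t−1} ≤ (c∕b + 1)(s+1)θ^{2E}`. [folklore] -/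
theorem twoParam_second_factor_le {c θ b : ℝ} (hc : 0 < c) (hθ0 : 0 < θ) (hb : 0 < b) (E s : ℕ)
    {a : ℕ → ℕ} (ha : ∀ t, a t = 2 * E * (t + 1) + 1) :
    c * θ ^ (a 0 - 1) / (s + 1) / b + ∑ t ∈ range s, θ ^ (a (t + 1) - 1) / θ ^ (a t - 1)
      ≤ (c / b + 1) * ((s : ℝ) + 1) * θ ^ (2 * E) := by
  have hx : (0 : ℝ) ≤ (s : ℝ) := Nat.cast_nonneg s
  have ha0 : a 0 - 1 = 2 * E := by rw [ha]; omega
  have hrat : ∀ t, θ ^ (a (t + 1) - 1) / θ ^ (a t - 1) = θ ^ (2 * E) := fun t => by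
    rw [div_eq_iff (pow_ne_zero _ hθ0.ne'), ← pow_add]
    congr 1; rw [ha, ha]; ring_nf; omega
  rw [ha0, sum_congr rfl fun t _ => hrat t, sum_const, card_range, nsmul_eq_mul]
  have h1 : c * θ ^ (2 * E) / (s + 1) / b ≤ c / b * θ ^ (2 * E) := by
    rw [div_div, div_le_iff₀ (by positivity)]
    have e : c / b * θ ^ (2 * E) * ((↑s + 1) * b) = c * θ ^ (2 * E) * (s + 1) := by field_simp
    rw [e]
    nlinarith [mul_nonneg (mul_nonneg hc.le (pow_nonneg hθ0.le (2 * E))) hx]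
  have h4 : 0 ≤ c / b * θ ^ (2 * E) * s := by positivity
  have h5 : 0 ≤ θ ^ (2 * E) := pow_nonneg hθ0.le _
  have e : (c / b + 1) * (↑s + 1) * θ ^ (2 * E)
      = c / b * θ ^ (2 * E) + ↑s * θ ^ (2 * E) + c / b * θ ^ (2 * E) * s + θ ^ (2 * E) := by ring
  linarith

/-- The two-parameter cost is at most `(1 + 1∕γ² + 5(b+c))³·(c∕b + 1)·(E+1)³·(s+1)⁷·θ^{2E}`. [folklore] -/
theorem twoParam_cost_le {c θ γ b : ℝ} (hc : 0 < c) (hθ0 : 0 < θ) (hγ : 0 < γ) (hb : 0 < b) (E s : ℕ)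
    {a k : ℕ → ℕ} (ha : ∀ t, a t = 2 * E * (t + 1) + 1) (hk : ∀ t, k t = 2 * E + t * (2 * E + 1) + E * t * (t + 1)) :
    (1 + (1 / γ ^ 2 + (b + c) * (k s + 2))) ^ 3 *
        (c * θ ^ (a 0 - 1) / (s + 1) / b + ∑ t ∈ range s, θ ^ (a (t + 1) - 1) / θ ^ (a t - 1))
      ≤ (1 + 1 / γ ^ 2 + 5 * (b + c)) ^ 3 * (c / b + 1) * ((E : ℝ) + 1) ^ 3 * ((s : ℝ) + 1) ^ 7 * θ ^ (2 * E) := by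
  have hG0 : 0 ≤ c * θ ^ (a 0 - 1) / (s + 1) / b + ∑ t ∈ range s, θ ^ (a (t + 1) - 1) / θ ^ (a t - 1) :=
    add_nonneg (div_nonneg (div_nonneg (mul_nonneg hc.le (pow_nonneg hθ0.le _)) (by positivity)) hb.le)
      (sum_nonneg fun t _ => div_nonneg (pow_nonneg hθ0.le _) (pow_nonneg hθ0.le _))
  have hR0 : 0 ≤ (1 + 1 / γ ^ 2 + 5 * (b + c)) ^ 3 * ((E : ℝ) + 1) ^ 3 * ((s : ℝ) + 1) ^ 6 :=
    mul_nonneg (mul_nonneg (pow_nonneg (by positivity) 3) (pow_nonneg (by positivity) 3)) (pow_nonneg (by positivity) 6)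
  refine (mul_le_mul (twoParam_first_factor_le hc hγ hb E s hk) (twoParam_second_factor_le hc hθ0 hb E s ha) hG0 hR0).trans
    (le_of_eq ?_)
  rw [show ((s : ℝ) + 1) ^ 7 = ((s : ℝ) + 1) ^ 6 * ((s : ℝ) + 1) from pow_succ _ 6]
  ring

/-- **THE TWO-PARAMETER WITNESS.**  For all constants and every depth `E` and stage count `s` with `cθ^{2E} ≤ b`: a family, moduli and two
pinned runs (`K = k_s + 1`, `k_s = 2E + s(2E+1) + E·s(s+1)`) with the whole binder list of (E33g), rows bounded by the two-parameter cost,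
and `disc gA gB (k_s) ≥ cθ^{2E(s+1)}∕(s+1)` (`witness_core` with `a_t = 2E(t+1) + 1`). [cite: Balaban1987RG1, (0.20) p.256 and §5 p.298] -/
theorem witness_twoParam {c θ γ b : ℝ} (hc : 0 < c) (hθ0 : 0 < θ) (hθ1 : θ < 1) (hγ : 0 < γ) (hb : 0 < b) (E s : ℕ)
    (hEb : c * θ ^ (2 * E) ≤ b) :
    ∃ (β : HBeta) (Λ : ℕ → ℕ → ℝ) (gA gB : ℕ → ℝ),
      RGEqH (2 * E + s * (2 * E + 1) + E * s * (s + 1) + 1) β gA ∧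
      RGEqH (2 * E + s * (2 * E + 1) + E * s * (s + 1) + 1 + 1) β gB ∧
      (∀ i, i ≤ 2 * E + s * (2 * E + 1) + E * s * (s + 1) + 1 → 0 < gA i ∧ gA i ≤ γ) ∧
      (∀ i, i ≤ 2 * E + s * (2 * E + 1) + E * s * (s + 1) + 1 + 1 → 0 < gB i ∧ gB i ≤ γ) ∧
      gA (2 * E + s * (2 * E + 1) + E * s * (s + 1) + 1) = gB (2 * E + s * (2 * E + 1) + E * s * (s + 1) + 1 + 1) ∧
      ScaleShiftRate c θ γ β ∧ HistLipschitz Λ γ β ∧ (∀ kk i, i ≤ kk → 0 ≤ Λ kk i) ∧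
      (∀ kk, ∑ i ∈ range (kk + 1), Λ kk i ≤
        (1 + 1 / γ ^ 2 + 5 * (b + c)) ^ 3 * (c / b + 1) * ((E : ℝ) + 1) ^ 3 * ((s : ℝ) + 1) ^ 7 * θ ^ (2 * E)) ∧
      BetaLowerH 0 γ β ∧ EventualLowerH b γ 0 β ∧
      c * θ ^ (2 * E * (s + 1)) / (s + 1) ≤ disc gA gB (2 * E + s * (2 * E + 1) + E * s * (s + 1)) := by
  obtain ⟨a, ha⟩ : ∃ a : ℕ → ℕ, ∀ t, a t = 2 * E * (t + 1) + 1 := ⟨_, fun _ => rfl⟩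
  obtain ⟨k, hk⟩ : ∃ k : ℕ → ℕ, ∀ t, k t = 2 * E + t * (2 * E + 1) + E * t * (t + 1) := ⟨_, fun _ => rfl⟩
  have ha0 : a 0 = k 0 + 1 := by rw [ha, hk]; ring
  have hak : ∀ t, t < s → k (t + 1) = k t + a (t + 1) := fun t _ => by rw [hk, hk, ha]; ring
  have hεb : ∀ t, t ≤ s → c * θ ^ (a t - 1) / (s + 1) ≤ b := by
    intro t _
    have hst : 2 * E ≤ a t - 1 := by rw [ha, Nat.add_sub_cancel]; exact Nat.le_mul_of_pos_right _ (Nat.succ_pos t)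
    have hle : c * θ ^ (a t - 1) ≤ c * θ ^ (2 * E) := mul_le_mul_of_nonneg_left (pow_le_pow_of_le_one hθ0.le hθ1.le hst) hc.le
    have hd : c * θ ^ (a t - 1) / (s + 1) ≤ c * θ ^ (a t - 1) :=
      div_le_self (by positivity) (by linarith [(Nat.cast_nonneg s : (0 : ℝ) ≤ s)])
    linarith
  obtain ⟨β, Λ, gA, gB, hRA, hRB, hAbox, hBbox, hpin, hSSR, hHL, hΛ0, hrows, hsign, hfloor, hdisc⟩ :=
    witness_core hc hθ0 hθ1.le hγ hb ha0 hak hεb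
  have hks : k s = 2 * E + s * (2 * E + 1) + E * s * (s + 1) := hk s
  have has : a s - 1 = 2 * E * (s + 1) := by rw [ha, Nat.add_sub_cancel]
  rw [hks] at hRA hRB hAbox hBbox hpin hdisc
  rw [has] at hdisc
  exact ⟨β, Λ, gA, gB, hRA, hRB, hAbox, hBbox, hpin, hSSR, hHL, hΛ0,
    fun kk => (hrows kk).trans (twoParam_cost_le hc hθ0 hγ hb E s ha hk), hsign, hfloor, hdisc⟩

/-! ## §2 Dyadic stages: `s = 2^m` stages of depth unit `N` (`E = N·m`) -/

/-- A depth unit: `N ≥ 1` with `θ^{2N} ≤ 1∕256`. [folklore] -/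
theorem exists_depth_unit {θ : ℝ} (hθ0 : 0 < θ) (hθ1 : θ < 1) : ∃ N : ℕ, 1 ≤ N ∧ θ ^ (2 * N) ≤ 1 / 256 := by
  have hθ2 : θ ^ 2 < 1 := by nlinarith
  obtain ⟨N, hN⟩ := exists_pow_lt_of_lt_one (by norm_num : (0 : ℝ) < 1 / 256) hθ2
  refine ⟨N, ?_, by rw [pow_mul]; exact hN.le⟩
  rcases Nat.eq_zero_or_pos N with h | h
  · subst h; norm_num at hN
  · exact h

/-- The dyadic cost: with `θ^{2N} ≤ 1∕256`, `(Nm + 1)³·(2^m + 1)⁷·θ^{2Nm} ≤ 128·(N+1)³·(m+1)³·(1∕2)^m`. [folklore] -/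
theorem dyadic_cost_le {θ : ℝ} (hθ0 : 0 < θ) {N : ℕ} (hN : θ ^ (2 * N) ≤ 1 / 256) (m : ℕ) :
    (((N * m : ℕ) : ℝ) + 1) ^ 3 * ((((2 : ℕ) ^ m : ℕ) : ℝ) + 1) ^ 7 * θ ^ (2 * (N * m))
      ≤ 128 * ((N : ℝ) + 1) ^ 3 * ((m : ℝ) + 1) ^ 3 * (1 / 2) ^ m := by
  have hNm : ((N * m : ℕ) : ℝ) + 1 ≤ ((N : ℝ) + 1) * ((m : ℝ) + 1) := by
    push_cast; nlinarith [Nat.cast_nonneg (α := ℝ) N, Nat.cast_nonneg (α := ℝ) m]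
  have h1 : (((N * m : ℕ) : ℝ) + 1) ^ 3 ≤ (((N : ℝ) + 1) * ((m : ℝ) + 1)) ^ 3 :=
    pow_le_pow_left₀ (by positivity) hNm 3
  have h2 : ((((2 : ℕ) ^ m : ℕ) : ℝ) + 1) ^ 7 ≤ 128 * (128 : ℝ) ^ m := by
    have h3 : ((((2 : ℕ) ^ m : ℕ) : ℝ) + 1) ≤ 2 * (2 : ℝ) ^ m := by
      push_cast; linarith [one_le_pow₀ (by norm_num : (1 : ℝ) ≤ 2) (n := m)]
    calc ((((2 : ℕ) ^ m : ℕ) : ℝ) + 1) ^ 7 ≤ (2 * (2 : ℝ) ^ m) ^ 7 := pow_le_pow_left₀ (by positivity) h3 7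
      _ = 128 * (128 : ℝ) ^ m := by rw [mul_pow, ← pow_mul, mul_comm m 7, pow_mul]; norm_num
  have h4 : θ ^ (2 * (N * m)) ≤ (1 / 256 : ℝ) ^ m := by
    rw [← mul_assoc, pow_mul]; exact pow_le_pow_left₀ (by positivity) hN m
  have h5 : (128 : ℝ) ^ m * (1 / 256 : ℝ) ^ m = (1 / 2) ^ m := by rw [← mul_pow]; norm_num
  calc (((N * m : ℕ) : ℝ) + 1) ^ 3 * ((((2 : ℕ) ^ m : ℕ) : ℝ) + 1) ^ 7 * θ ^ (2 * (N * m))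
      ≤ (((N : ℝ) + 1) * ((m : ℝ) + 1)) ^ 3 * (128 * (128 : ℝ) ^ m) * (1 / 256 : ℝ) ^ m :=
        mul_le_mul (mul_le_mul h1 h2 (by positivity) (by positivity)) h4 (by positivity) (by positivity)
    _ = 128 * ((N : ℝ) + 1) ^ 3 * ((m : ℝ) + 1) ^ 3 * (1 / 2) ^ m := by rw [← h5]; ring

/-- The logarithmic bookkeeping of the dyadic witness: for `m ≥ 1`,
`log(2^m + 1) + 2N|log θ|·m·(2^m + 1) ≤ (2 + 4N|log θ|∕log 2)·2^m·log(2^m)`. [folklore] -/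
theorem dyadic_log_le {θ : ℝ} (hθ0 : 0 < θ) (hθ1 : θ < 1) (N : ℕ) {m : ℕ} (hm : 1 ≤ m) :
    Real.log ((2 : ℝ) ^ m + 1) + 2 * N * (-Real.log θ) * m * ((2 : ℝ) ^ m + 1)
      ≤ (2 + 4 * N * (-Real.log θ) / Real.log 2) * (2 : ℝ) ^ m * Real.log ((2 : ℝ) ^ m) := by
  have hlog2 : 0 < Real.log 2 := Real.log_pos (by norm_num)
  have hα : 0 ≤ -Real.log θ := by linarith [Real.log_neg hθ0 hθ1]
  have hu : (1 : ℝ) ≤ (2 : ℝ) ^ m := one_le_pow₀ (by norm_num)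
  have hm1 : (1 : ℝ) ≤ (m : ℝ) := by exact_mod_cast hm
  rw [Real.log_pow]
  have h1 : Real.log ((2 : ℝ) ^ m + 1) ≤ ((m : ℝ) + 1) * Real.log 2 := by
    rw [← Real.log_rpow (by norm_num : (0 : ℝ) < 2), Real.rpow_add_one (by norm_num), Real.rpow_natCast]
    exact Real.log_le_log (by positivity) (by linarith)
  have h2 : ((m : ℝ) + 1) * Real.log 2 ≤ 2 * (2 : ℝ) ^ m * ((m : ℝ) * Real.log 2) := by
    nlinarith [mul_nonneg (sub_nonneg.mpr hu) (mul_nonneg (by linarith : (0 : ℝ) ≤ m) hlog2.le)]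
  have h3 : 2 * N * (-Real.log θ) * m * ((2 : ℝ) ^ m + 1) ≤ 4 * N * (-Real.log θ) * ((2 : ℝ) ^ m * m) := by
    have : (2 : ℝ) ^ m + 1 ≤ 2 * (2 : ℝ) ^ m := by linarith
    nlinarith [mul_nonneg (mul_nonneg (by positivity : (0 : ℝ) ≤ 2 * N) hα) (by linarith : (0 : ℝ) ≤ m)]
  have e : (2 + 4 * N * (-Real.log θ) / Real.log 2) * (2 : ℝ) ^ m * ((m : ℝ) * Real.log 2)
      = 2 * (2 : ℝ) ^ m * ((m : ℝ) * Real.log 2) + 4 * N * (-Real.log θ) * ((2 : ℝ) ^ m * m) := by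
    field_simp
  linarith

/-- The dyadic choice of the size: for `p > ½`, `A > 0` and all targets there is `m ≥ 1` with the dyadic cost below `M`, `cθ^{2Nm} ≤ b`,
and `log(C∕c) + log(2^m + 1) + 2N|log θ|·m·(2^m + 1) < A·((2^m)²)^p` (`log x = o(x^{2p−1})`, as in (E34b)). [folklore] -/
theorem exists_dyadic {c θ b M D A C p : ℝ} (hθ0 : 0 < θ) (hθ1 : θ < 1) (hb : 0 < b) (hM : 0 < M)
    (hp : 1 / 2 < p) (hA : 0 < A) {N : ℕ} (hN : θ ^ (2 * N) ≤ 1 / 256) :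
    ∃ m : ℕ, 1 ≤ m ∧ D * (128 * ((N : ℝ) + 1) ^ 3 * ((m : ℝ) + 1) ^ 3 * (1 / 2) ^ m) ≤ M ∧ c * θ ^ (2 * (N * m)) ≤ b ∧
      Real.log (C / c) + Real.log ((2 : ℝ) ^ m + 1) + 2 * N * (-Real.log θ) * m * ((2 : ℝ) ^ m + 1)
        < A * (((2 : ℝ) ^ m) ^ 2) ^ p := by
  have hlog2 : 0 < Real.log 2 := Real.log_pos (by norm_num)
  have hα : 0 ≤ -Real.log θ := by linarith [Real.log_neg hθ0 hθ1]
  set B : ℝ := 2 + 4 * N * (-Real.log θ) / Real.log 2 with hBdef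
  have hB0 : 0 < B := by positivity
  -- (1) cost
  have e1 : ∀ᶠ m : ℕ in atTop, D * (128 * ((N : ℝ) + 1) ^ 3 * ((m : ℝ) + 1) ^ 3 * (1 / 2) ^ m) ≤ M := by
    have h := (tendsto_succ_pow_mul_pow (by norm_num : (0 : ℝ) < 1 / 2) (by norm_num) 3).const_mul
      (D * (128 * ((N : ℝ) + 1) ^ 3))
    rw [mul_zero] at h
    refine (h.eventually (eventually_le_nhds hM)).mono fun m hm => ?_
    simpa [mul_assoc] using hm
  -- (2) amplitude floor
  have e2 : ∀ᶠ m : ℕ in atTop, c * θ ^ (2 * (N * m)) ≤ b := by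
    have hq1 : θ ^ (2 * N) < 1 := lt_of_le_of_lt hN (by norm_num)
    have h := (tendsto_pow_atTop_nhds_zero_of_lt_one (by positivity) hq1).const_mul c
    rw [mul_zero] at h
    refine (h.eventually (eventually_le_nhds hb)).mono fun m hm => ?_
    rwa [← mul_assoc, pow_mul]
  -- (3) the logarithmic inequality, first in a real variable
  have hq : 0 < 2 * p - 1 := by linarith
  have hev : ∀ᶠ x : ℝ in atTop, B * x * Real.log x + Real.log (C / c) < A * (x ^ 2) ^ p := by
    have h1 : ∀ᶠ x : ℝ in atTop, ‖Real.log x‖ ≤ A / (2 * B) * ‖x ^ (2 * p - 1)‖ :=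
      (isLittleO_log_rpow_atTop hq).bound (by positivity)
    have h2 : Tendsto (fun x : ℝ => x ^ (2 * p)) atTop atTop := tendsto_rpow_atTop (by linarith)
    have h3 : ∀ᶠ x : ℝ in atTop, Real.log (C / c) * (2 / A) + 1 ≤ x ^ (2 * p) := h2.eventually_ge_atTop _
    filter_upwards [h1, h3, eventually_ge_atTop (1 : ℝ)] with x hx1 hx3 hx
    have hx0 : 0 < x := by linarith
    have hlog0 : 0 ≤ Real.log x := Real.log_nonneg hx
    rw [Real.norm_eq_abs, Real.norm_eq_abs, abs_of_nonneg hlog0, abs_of_nonneg (Real.rpow_nonneg hx0.le _)] at hx1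
    have e1' : (x ^ 2) ^ p = x ^ (2 * p) := by
      rw [← Real.rpow_two, ← Real.rpow_mul hx0.le]
    have e2' : x * x ^ (2 * p - 1) = x ^ (2 * p) := by
      rw [mul_comm, ← Real.rpow_add_one hx0.ne']; ring_nf
    have h4 : B * x * Real.log x ≤ A / 2 * x ^ (2 * p) := by
      have h5 := mul_le_mul_of_nonneg_left hx1 (by positivity : 0 ≤ B * x)
      calc B * x * Real.log x ≤ B * x * (A / (2 * B) * x ^ (2 * p - 1)) := h5
        _ = A / 2 * (x * x ^ (2 * p - 1)) := by field_simp
        _ = A / 2 * x ^ (2 * p) := by rw [e2']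
    have h6 : Real.log (C / c) < A / 2 * x ^ (2 * p) := by
      have hA2 : 0 < A / 2 := by positivity
      have e3 : Real.log (C / c) = A / 2 * (Real.log (C / c) * (2 / A)) := by field_simp
      rw [e3]
      exact mul_lt_mul_of_pos_left (by linarith) hA2
    rw [e1']
    linarith
  have e3 : ∀ᶠ m : ℕ in atTop, B * (2 : ℝ) ^ m * Real.log ((2 : ℝ) ^ m) + Real.log (C / c) < A * (((2 : ℝ) ^ m) ^ 2) ^ p :=
    (tendsto_pow_atTop_atTop_of_one_lt (by norm_num : (1 : ℝ) < 2)).eventually hev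
  obtain ⟨m, hm1, hm2, hm3, hm4⟩ := ((eventually_ge_atTop 1).and (e1.and (e2.and e3))).exists
  refine ⟨m, hm1, hm2, hm3, ?_⟩
  have h7 := dyadic_log_le hθ0 hθ1 N hm1
  rw [← hBdef] at h7
  linarith

/-! ## §3 The β-level envelope: no `C·exp(−A·j^p)` bound with `p > ½` -/

/-- **NO `exp(−A·j^p)` TWO-RUN MATCHING RATE WITH `p > ½` AT THE β LEVEL (E35d) — the exponent `½` of (E33g) is optimal up to the
logarithm, realized by admissible families.**  For ALL class constants `c > 0`, `0 < θ < 1`, `γ > 0`, `b > 0`, `M > 0` and EVERY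
`p > ½`, `A > 0`, `C`, there are a history family `β`, moduli `Λ`, a cutoff `K`, two pinned runs of (0.20) in the box and `j ≤ K`
satisfying EVERY binder of (E33g) `disc_le_sqrt_uniform_sign` (`ScaleShiftRate c θ γ β`, `HistLipschitz Λ γ β` with `Λ ≥ 0` and
rows `≤ M`, `BetaLowerH 0 γ β`, `EventualLowerH b γ 0 β`) with `disc gA gB j > C·exp(−A·j^p)` — the β-level companion of (E34b)
`rowSystem_not_stretched_pow` (there: through the row system; here: an admissible family).  WITNESS: the two-parameter pattern of §1 at
the DYADIC size `s = 2^m` stages of depth `E = N·m` (`θ^{2N} ≤ 1∕256`): `j = k_s ≥ 4^m`, `disc ≥ cθ^{2Nm(2^m+1)}∕(2^m+1)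
= c·exp(−2N|log θ|·m·(2^m+1))∕(2^m+1)`, i.e. `ln(1∕disc_j) ≍ √(j·log j)` along the witnesses, against the row budget
`(1 + 1∕γ² + 5(b+c))³(c∕b+1)·128(N+1)³(m+1)³(1∕2)^m ≤ M`; `log x = o(x^{2p−1})` places `C·exp(−A·j^p)` below it.  HONEST: a WITNESS
about the cell's NOT-IN-PRINT binders (GAPS G-t4-U2-1∕-2); nothing of [I] (1.22) asserted; NOT B12 Thm 2, NOT BetaPertH, NOT continuum,
NOT Clay. [cite: Balaban1987RG1, (0.20) p.256 and §5 p.298] -/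
theorem not_stretched_pow {c θ γ b M : ℝ} (hc : 0 < c) (hθ0 : 0 < θ) (hθ1 : θ < 1) (hγ : 0 < γ) (hb : 0 < b) (hM : 0 < M)
    {p A : ℝ} (hp : 1 / 2 < p) (hA : 0 < A) (C : ℝ) :
    ∃ (β : HBeta) (Λ : ℕ → ℕ → ℝ) (K : ℕ) (gA gB : ℕ → ℝ) (j : ℕ),
      RGEqH K β gA ∧ RGEqH (K + 1) β gB ∧
      (∀ i, i ≤ K → 0 < gA i ∧ gA i ≤ γ) ∧ (∀ i, i ≤ K + 1 → 0 < gB i ∧ gB i ≤ γ) ∧ gA K = gB (K + 1) ∧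
      ScaleShiftRate c θ γ β ∧ HistLipschitz Λ γ β ∧ (∀ k i, i ≤ k → 0 ≤ Λ k i) ∧
      (∀ k, ∑ i ∈ range (k + 1), Λ k i ≤ M) ∧ BetaLowerH 0 γ β ∧ EventualLowerH b γ 0 β ∧
      j ≤ K ∧ C * Real.exp (-A * (j : ℝ) ^ p) < disc gA gB j := by
  obtain ⟨N, hN1, hN⟩ := exists_depth_unit hθ0 hθ1
  set D : ℝ := (1 + 1 / γ ^ 2 + 5 * (b + c)) ^ 3 * (c / b + 1) with hDdef
  have hD : 0 ≤ D := by positivity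
  obtain ⟨m, hm1, hcost, hEb, hlog⟩ := exists_dyadic (c := c) (C := C) (D := D) hθ0 hθ1 hb hM hp hA hN
  -- the two-parameter witness at E = N m, s = 2^m
  obtain ⟨β, Λ, gA, gB, hRA, hRB, hAbox, hBbox, hpin, hSSR, hHL, hΛ0, hrows, hsign, hfloor, hdisc⟩ :=
    witness_twoParam hc hθ0 hθ1 hγ hb (N * m) (2 ^ m) hEb
  set E : ℕ := N * m with hE
  set s : ℕ := 2 ^ m with hs
  set j : ℕ := 2 * E + s * (2 * E + 1) + E * s * (s + 1) with hj
  refine ⟨β, Λ, j + 1, gA, gB, j, hRA, hRB, hAbox, hBbox, hpin, hSSR, hHL, hΛ0, fun kk => ?_, hsign, hfloor, Nat.le_succ _, ?_⟩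
  · refine (hrows kk).trans (le_trans ?_ hcost)
    rw [hDdef, hE, hs]
    have h := dyadic_cost_le hθ0 hN m
    have hD0 : 0 ≤ (1 + 1 / γ ^ 2 + 5 * (b + c)) ^ 3 * (c / b + 1) := hD
    calc (1 + 1 / γ ^ 2 + 5 * (b + c)) ^ 3 * (c / b + 1) * (((N * m : ℕ) : ℝ) + 1) ^ 3 *
          ((((2 : ℕ) ^ m : ℕ) : ℝ) + 1) ^ 7 * θ ^ (2 * (N * m))
        = (1 + 1 / γ ^ 2 + 5 * (b + c)) ^ 3 * (c / b + 1) *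
          ((((N * m : ℕ) : ℝ) + 1) ^ 3 * ((((2 : ℕ) ^ m : ℕ) : ℝ) + 1) ^ 7 * θ ^ (2 * (N * m))) := by ring
      _ ≤ (1 + 1 / γ ^ 2 + 5 * (b + c)) ^ 3 * (c / b + 1) * (128 * ((N : ℝ) + 1) ^ 3 * ((m : ℝ) + 1) ^ 3 * (1 / 2) ^ m) :=
          mul_le_mul_of_nonneg_left h hD0
  · refine lt_of_lt_of_le ?_ hdisc
    have hspos : (0 : ℝ) < (s : ℝ) + 1 := by positivity
    have hpos : (0 : ℝ) < c * θ ^ (2 * E * (s + 1)) / (s + 1) := by positivity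
    rcases le_or_gt C 0 with hC | hC
    · exact lt_of_le_of_lt (mul_nonpos_of_nonpos_of_nonneg hC (Real.exp_pos _).le) hpos
    -- j ≥ s² = (2^m)²
    have hE1 : 1 ≤ E := by rw [hE]; exact Nat.one_le_iff_ne_zero.mpr (Nat.mul_ne_zero (by omega) (by omega))
    have hjs : s * s ≤ j := by
      rw [hj]
      have : s * s ≤ E * s * (s + 1) := by nlinarith [Nat.zero_le s]
      omega
    have hscast : ((s : ℕ) : ℝ) = (2 : ℝ) ^ m := by rw [hs]; push_cast; rfl
    have hjp : (((2 : ℝ) ^ m) ^ 2) ^ p ≤ (j : ℝ) ^ p := by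
      refine Real.rpow_le_rpow (by positivity) ?_ (by linarith)
      rw [← hscast, sq]; exact_mod_cast hjs
    -- the exponent bookkeeping: θ^{2E(s+1)} = exp(−2N|log θ|·m·(2^m+1))
    have hθpow : θ ^ (2 * E * (s + 1)) = Real.exp (-(2 * N * (-Real.log θ) * m * ((2 : ℝ) ^ m + 1))) := by
      rw [← Real.exp_log (pow_pos hθ0 _), Real.log_pow, hE, hs]
      congr 1; push_cast; ring
    have hsR : ((s : ℝ) + 1) = (2 : ℝ) ^ m + 1 := by rw [hscast]
    rw [hθpow, hsR]
    -- from `hlog`: log(C∕c) < A·((2^m)²)^p − (log(2^m+1) + 2N|log θ| m (2^m+1))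
    have hu1 : (0 : ℝ) < (2 : ℝ) ^ m + 1 := by positivity
    have h6 : Real.log (C / c) < A * (((2 : ℝ) ^ m) ^ 2) ^ p -
        (Real.log ((2 : ℝ) ^ m + 1) + 2 * N * (-Real.log θ) * m * ((2 : ℝ) ^ m + 1)) := by linarith
    have h7 : C / c < Real.exp (A * (((2 : ℝ) ^ m) ^ 2) ^ p) *
        (Real.exp (-(2 * N * (-Real.log θ) * m * ((2 : ℝ) ^ m + 1))) / ((2 : ℝ) ^ m + 1)) := by
      calc C / c = Real.exp (Real.log (C / c)) := (Real.exp_log (div_pos hC hc)).symm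
        _ < Real.exp (A * (((2 : ℝ) ^ m) ^ 2) ^ p -
            (Real.log ((2 : ℝ) ^ m + 1) + 2 * N * (-Real.log θ) * m * ((2 : ℝ) ^ m + 1))) := Real.exp_lt_exp.mpr h6
        _ = _ := by
            rw [Real.exp_sub, Real.exp_add, Real.exp_log hu1, div_eq_mul_inv, div_eq_mul_inv, Real.exp_neg]
            field_simp
    have h8 : C < c * (Real.exp (A * (((2 : ℝ) ^ m) ^ 2) ^ p) *
        (Real.exp (-(2 * N * (-Real.log θ) * m * ((2 : ℝ) ^ m + 1))) / ((2 : ℝ) ^ m + 1))) := (div_lt_iff₀' hc).mp h7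
    have h9 : Real.exp (-A * (j : ℝ) ^ p) ≤ Real.exp (-(A * (((2 : ℝ) ^ m) ^ 2) ^ p)) := by
      have := mul_le_mul_of_nonneg_left hjp hA.le
      exact Real.exp_le_exp.mpr (by linarith)
    calc C * Real.exp (-A * (j : ℝ) ^ p) ≤ C * Real.exp (-(A * (((2 : ℝ) ^ m) ^ 2) ^ p)) :=
          mul_le_mul_of_nonneg_left h9 hC.le
      _ < c * (Real.exp (A * (((2 : ℝ) ^ m) ^ 2) ^ p) *
            (Real.exp (-(2 * N * (-Real.log θ) * m * ((2 : ℝ) ^ m + 1))) / ((2 : ℝ) ^ m + 1))) *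
            Real.exp (-(A * (((2 : ℝ) ^ m) ^ 2) ^ p)) := mul_lt_mul_of_pos_right h8 (Real.exp_pos _)
      _ = c * Real.exp (-(2 * N * (-Real.log θ) * m * ((2 : ℝ) ^ m + 1))) / ((2 : ℝ) ^ m + 1) := by
          rw [Real.exp_neg (A * _)]
          field_simp

end Summit.QuantumFields.BalabanUV.Beta.EriceRemainderEnclosureHistoryRenewalWitnessEnvelope

end
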